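import Mathlib
import HarnessLib
import Literature.MathematicalPhysics.QuantumLattice.GaugeGroups
import Literature.MathematicalPhysics.QuantumFieldTheory.ConstructiveQFTWave0
import Literature.MathematicalPhysics.QuantumFieldTheory.LatticeGaugeProofs
import Literature.MathematicalPhysics.QuantumFieldTheory.U1GinibreComparison
import Literature.MathematicalPhysics.QuantumLattice.AbelianFieldTensor
import Literature.MathematicalPhysics.QuantumLattice.AbelianMagneticFlux
import Summits.Ventures.LatticeQCDFlow.Exactness.SymmetricMetropolis
import Summits.Ventures.LatticeQCDFlow.Exactness.CompactHaar
import Summits.Ventures.LatticeQCDFlow.Scaling.LatticePeeling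
import Summits.Ventures.LatticeQCDFlow.Scaling.SliceTwistWitness
import Summits.Ventures.LatticeQCDFlow.Scaling.FluxTunnellingU1Explicit
import Summits.Ventures.LatticeQCDFlow.Scaling.BoxSpreadWitness
import Summits.Ventures.LatticeQCDFlow.Scaling.BoxTouch
import Summits.Ventures.LatticeQCDFlow.Scaling.FluxInsertionKernel
import Summits.Ventures.LatticeQCDFlow.Scaling.FluxInsertionLine
import Summits.Ventures.LatticeQCDFlow.Scaling.FluxInsertionBox
import Summits.Ventures.LatticeQCDFlow.Scaling.ConvolutionPowerCompensation
import Summits.Ventures.LatticeQCDFlow.Scaling.WilsonPatchLowerBound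
import Summits.Ventures.LatticeQCDFlow.Scaling.TiltedPatchEstimate
import Summits.Ventures.LatticeQCDFlow.Scaling.FluxInsertionSharpFloor

/-!
# The sharp tunnelling floor, instances: the wrapping LINE (`N = L`) and the solid BLOCK (`N = (l−1)(l+3)`)

HONEST FRAMING: exact (Metropolis-corrected) sampling algorithms for lattice gauge theory;
figures of merit are autocorrelation/cost numbers at stated couplings and volumes; no
continuum-physics claim.

Venture `LatticeQCDFlow` (cell pub-lqcd), topic `Scaling`, FANOUT row 29 (theory2, gen-20), item 104b
(imports item 104a `Scaling/FluxInsertionSharpFloor`: the generic theorem `u1_patchInsertion_sharp_floor`).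
NEW WORK; nothing here is cited as a fact.  `U(1)`, `d = 2`, Wilson action, torus `(ℤ/L)²`,
`μ_{β,L} = wilsonMeasure u1Rep β`, `Q = Flux.topCharge 0 0 1`, `κ = β cos θ`.

* §4 the LINE: `lineSites L = {x : x 0 = 0}` (`card_lineSites : # = L`); for gen-19's line-insertion
  kernel `K_line = insertionMH (sliceTwist L) e^{−βS}` (item 99), `3 ≤ L`, `β ≥ 0`, `θ = π/L`, `κ ≥ 1`,
  `lam ≥ 0`, any `η`:
  **`u1_lineInsertion_sharp_floor`**
  `¼·e^{−β(L²−L)(1−cos(π/(L²−L−1)))}·e^{−(Lβ(1−cos θ) + β sin θ·η)}·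
   (1 − 2e^{−lam·η + L·lam²/(2κ)} − L·πe^{1/2}√κ·e^{−κ(1+cos 3θ)}) ≤ (μ_{β,L} ⊗ K_line){Q ≠ Q'}`,
  and its real-number form `u1_lineInsertion_sharp_floor_real`;
* §5 the BLOCK: `boxSites l L` = the `(l+1)² − 4` touching positions of gen-19's block spread
  (`card_boxSites`, via item 95's `card_boxPositionsNat`); for the block-insertion kernel
  `K_box = insertionMH (boxSpread l) e^{−βS}` (item 100), `2 ≤ l`, `l + 1 ≤ L`, `θ = α_l/2 = π/N`,
  `N = (l−1)(l+3)`, `κ ≥ 1`, `lam ≥ 0`, any `η`: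
  **`u1_boxInsertion_sharp_floor`**
  `¼·e^{−β(L²−N)(1−cos(π/(L²−N−1)))}·e^{−(Nβ(1−cos θ) + β sin θ·η)}·
   (1 − 2e^{−lam·η + N·lam²/(2κ)} − N·πe^{1/2}√κ·e^{−κ(1+cos 3θ)}) ≤ (μ_{β,L} ⊗ K_box){Q ≠ Q'}`
  (`u1_boxInsertion_sharp_floor_real`) — the VOLUME enters only through the first factor, which
  tends to `1`; the RATE in `β` tends to the necessity rate `N(1 − cos(π/N))` of item 97 as `L → ∞`
  (THEORY-2.md v3.9 §4 C9′; values of the bound in `check/sharp104.out`).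
Elementary given items 99, 100, 104a; `def`s `lineSites`, `lineSite`, `boxSites`, `natSite`.
-/

noncomputable section

namespace Summit.Ventures.LatticeQCDFlow.Theory2.Lattice.Flux

open MeasureTheory ProbabilityTheory Real
open scoped ENNReal
open Literature.MathematicalPhysics.QuantumFieldTheory Literature.MathematicalPhysics.QuantumLattice
open Summit.Ventures.LatticeQCDFlow.Exactness
open Summit.Ventures.LatticeQCDFlow.Theory2.HaarConv

section TwoDim

variable {L : ℕ} [NeZero L]

/-! ## §4 The line: `N = L`, `θ = π/L` -/

/-- The plaquette positions of the wrapping line `{x : x₀ = 0}`. [folklore] -/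
def lineSites (L : ℕ) [NeZero L] : Finset (Site 2 L) := Finset.univ.filter fun x => x 0 = 0

/-- Membership. [folklore] -/
theorem mem_lineSites {x : Site 2 L} : x ∈ lineSites L ↔ x 0 = 0 := by simp [lineSites]

/-- The site `(0, b)`. [folklore] -/
def lineSite (b : ZMod L) : Site 2 L := fun i => if i = 0 then 0 else b

/-- `#lineSites = L`. [folklore] -/
theorem card_lineSites : (lineSites L).card = L := by
  have h0 : ∀ b : ZMod L, lineSite b 0 = 0 := fun b => if_pos rfl
  have h1 : ∀ b : ZMod L, lineSite b 1 = b := fun b => if_neg (by decide)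
  apply le_antisymm
  · calc (lineSites L).card ≤ (Finset.univ : Finset (ZMod L)).card :=
          Finset.card_le_card_of_injOn (fun x : Site 2 L => x 1) (fun _ _ => Finset.mem_coe.mpr (Finset.mem_univ _))
            (by
              intro x hx y hy hxy
              have hx0 : x 0 = 0 := mem_lineSites.mp (Finset.mem_coe.mp hx)
              have hy0 : y 0 = 0 := mem_lineSites.mp (Finset.mem_coe.mp hy)
              have hxy' : x 1 = y 1 := hxy
              funext i
              fin_cases i
              · exact hx0.trans hy0.symm
              · exact hxy')
      _ = L := by rw [Finset.card_univ, ZMod.card]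
  · calc L = (Finset.univ : Finset (ZMod L)).card := by rw [Finset.card_univ, ZMod.card]
      _ ≤ (lineSites L).card :=
          Finset.card_le_card_of_injOn (lineSite (L := L))
            (fun b _ => Finset.mem_coe.mpr (mem_lineSites.mpr (h0 b)))
            (by
              intro b _ b' _ h
              have := congrFun h 1
              rwa [h1, h1] at this)

/-- **THE SHARP FLOOR FOR THE LINE-INSERTION KERNEL** (`3 ≤ L`, `β ≥ 0`, `β cos(π/L) ≥ 1`, `λ ≥ 0`,
any `η`; `κ = β cos(π/L)`):
`¼ e^{−β(L²−L)(1−cos(π/(L²−L−1)))} · e^{−(Lβ(1−cos(π/L)) + β sin(π/L)·η)} ·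
 (1 − 2e^{−λη + Lλ²/(2κ)} − L·πe^{1/2}√κ·e^{−κ(1+cos(3π/L))}) ≤ (μ_{β,L} ⊗ K_line){Q ≠ Q'}`. [folklore] -/
theorem u1_lineInsertion_sharp_floor (hL : 3 ≤ L) {β l η : ℝ} (hβ : 0 ≤ β)
    (hκ : 1 ≤ β * Real.cos (π / L)) (hl : 0 ≤ l) :
    ENNReal.ofReal (4⁻¹ *
        Real.exp (-(β * (((L ^ 2 - L : ℕ) : ℝ) * (1 - Real.cos (π / ((L ^ 2 - L - 1 : ℕ) : ℝ)))))) *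
        Real.exp (-(L * (β - β * Real.cos (π / L)) + β * Real.sin (π / L) * η)) *
        (1 - 2 * Real.exp (-(l * η) + L * (l ^ 2 / (2 * (β * Real.cos (π / L))))) -
          L * (π * Real.exp (1 / 2) * Real.sqrt (β * Real.cos (π / L))) *
            Real.exp (-(β * Real.cos (π / L) * (1 + Real.cos (3 * (π / L))))))) ≤
      ((wilsonMeasure (d := 2) (L := L) u1Rep β) ⊗ₘ lineInsertionMH (L := L) β)
        {q | topCharge (0 : Site 2 L) 0 1 q.1 ≠ topCharge (0 : Site 2 L) 0 1 q.2} := by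
  have hLpos : (0 : ℝ) < L := by exact_mod_cast (show 0 < L by omega)
  have hL3 : (3 : ℝ) ≤ L := by exact_mod_cast hL
  have hθ3 : 3 * (π / L) ≤ π := by
    rw [mul_div_assoc', div_le_iff₀ hLpos]; nlinarith [Real.pi_pos]
  have hP : (lineSites L).card + 3 ≤ L ^ 2 := by rw [card_lineSites]; nlinarith
  have hXP : ∀ x ∈ lineSites L, plaquetteHolonomy (sliceTwist L)⁻¹ x 0 1 =
      Circle.exp (π / L) * Circle.exp (π / L) := by
    intro x hx
    rw [plaquetteHolonomy_inv, plaquetteHolonomy_sliceTwist, if_pos (mem_lineSites.mp hx), inv_inv,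
      toCircle_one_eq_exp, ← Circle.exp_add]
    congr 1; ring
  have hXn : ∀ x ∉ lineSites L, plaquetteHolonomy (sliceTwist L)⁻¹ x 0 1 = 1 := by
    intro x hx
    rw [plaquetteHolonomy_inv, plaquetteHolonomy_sliceTwist, if_neg (fun h => hx (mem_lineSites.mpr h)),
      inv_one]
  have hQ : ∀ U : GaugeConfig 2 L Circle,
      (∀ x ∈ lineSites L, 2 * (π / L) - π < abelianFieldTensor U x 0 1 ∧
        abelianFieldTensor U x 0 1 ≤ π - 2 * (π / L)) →
      topCharge (0 : Site 2 L) 0 1 ((sliceTwist L)⁻¹ * U) ≠ topCharge (0 : Site 2 L) 0 1 U := by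
    intro U hU
    refine (bothChange_of_branch hL (U := U) fun x hx0 => ?_).2
    have h := hU x (mem_lineSites.mpr hx0)
    rwa [show 2 * (π / (L : ℝ)) = 2 * π / L by ring] at h
  have h := u1_patchInsertion_sharp_floor (by omega) (θ := π / L) (η := η) hβ (by positivity) hθ3 hκ hl
    (sliceTwist L) (sliceTwist L)⁻¹ (Or.inr rfl) (lineSites L) hP hXP hXn hQ
  rw [card_lineSites] at h
  exact h

/-- **The line floor in real numbers.** [folklore] -/
theorem u1_lineInsertion_sharp_floor_real (hL : 3 ≤ L) {β l η : ℝ} (hβ : 0 ≤ β)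
    (hκ : 1 ≤ β * Real.cos (π / L)) (hl : 0 ≤ l) :
    4⁻¹ * Real.exp (-(β * (((L ^ 2 - L : ℕ) : ℝ) * (1 - Real.cos (π / ((L ^ 2 - L - 1 : ℕ) : ℝ)))))) *
        Real.exp (-(L * (β - β * Real.cos (π / L)) + β * Real.sin (π / L) * η)) *
        (1 - 2 * Real.exp (-(l * η) + L * (l ^ 2 / (2 * (β * Real.cos (π / L))))) -
          L * (π * Real.exp (1 / 2) * Real.sqrt (β * Real.cos (π / L))) *
            Real.exp (-(β * Real.cos (π / L) * (1 + Real.cos (3 * (π / L)))))) ≤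
      ((wilsonMeasure (d := 2) (L := L) u1Rep β) ⊗ₘ lineInsertionMH (L := L) β).real
        {q | topCharge (0 : Site 2 L) 0 1 q.1 ≠ topCharge (0 : Site 2 L) 0 1 q.2} := by
  haveI : IsProbabilityMeasure (wilsonMeasure (d := 2) (L := L) u1Rep β) :=
    isProbabilityMeasure_wilsonMeasure u1Rep continuous_u1Rep β
  rw [measureReal_def]
  exact (ENNReal.ofReal_le_iff_le_toReal (measure_ne_top _ _)).mp
    (u1_lineInsertion_sharp_floor hL hβ hκ hl)

/-! ## §5 The block: `N = (l−1)(l+3) = (l+1)² − 4`, `θ = α_l/2` -/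

variable {l : ℕ}

/-- The touching plaquette positions of the block, as sites. [folklore] -/
def boxSites (l L : ℕ) [NeZero L] : Finset (Site 2 L) :=
  Finset.univ.filter fun x => inR l (x 0).val (x 1).val

/-- Membership. [folklore] -/
theorem mem_boxSites {x : Site 2 L} : x ∈ boxSites l L ↔ inR l (x 0).val (x 1).val := by
  simp [boxSites]

/-- The site with natural-number coordinates `q`. [folklore] -/
def natSite (q : ℕ × ℕ) : Site 2 L := fun i => if i = 0 then (q.1 : ZMod L) else (q.2 : ZMod L)

/-- **`#boxSites = (l+1)² − 4 = (l−1)(l+3)`** (`2 ≤ l`, `l + 1 ≤ L`). [folklore] -/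
theorem card_boxSites (hl : 2 ≤ l) (hlL : l + 1 ≤ L) : (boxSites l L).card = (l + 1) * (l + 1) - 4 := by
  have h0 : ∀ q : ℕ × ℕ, natSite (L := L) q 0 = (q.1 : ZMod L) := fun q => if_pos rfl
  have h1 : ∀ q : ℕ × ℕ, natSite (L := L) q 1 = (q.2 : ZMod L) := fun q => if_neg (by decide)
  rw [← card_boxPositionsNat hl]
  have himage : boxSites l L = (boxPositionsNat l).image (natSite (L := L)) := by
    ext x
    simp only [mem_boxSites, Finset.mem_image]
    constructor
    · intro hx
      obtain ⟨ha, hb, hc⟩ := hx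
      refine ⟨((x 0).val, (x 1).val), ?_, ?_⟩
      · unfold boxPositionsNat
        simp only [Finset.mem_filter, Finset.mem_product, Finset.mem_range]
        exact ⟨⟨by omega, by omega⟩, hc⟩
      · funext i
        fin_cases i
        · exact (h0 _).trans (ZMod.natCast_zmod_val (x 0))
        · exact (h1 _).trans (ZMod.natCast_zmod_val (x 1))
    · rintro ⟨q, hq, rfl⟩
      unfold boxPositionsNat at hq
      simp only [Finset.mem_filter, Finset.mem_product, Finset.mem_range] at hq
      have e0 : (natSite (L := L) q 0).val = q.1 := by rw [h0]; exact ZMod.val_cast_of_lt (by omega)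
      have e1 : (natSite (L := L) q 1).val = q.2 := by rw [h1]; exact ZMod.val_cast_of_lt (by omega)
      rw [e0, e1]
      unfold inR
      exact ⟨by omega, by omega, hq.2⟩
  rw [himage]
  refine Finset.card_image_of_injOn ?_
  intro q hq q' hq' h
  have hq1 := Finset.mem_coe.mp hq
  have hq2 := Finset.mem_coe.mp hq'
  unfold boxPositionsNat at hq1 hq2
  simp only [Finset.mem_filter, Finset.mem_product, Finset.mem_range] at hq1 hq2
  have e0 := congrArg ZMod.val (congrFun h 0)
  have e1 := congrArg ZMod.val (congrFun h 1)
  rw [h0, h0, ZMod.val_cast_of_lt (by omega), ZMod.val_cast_of_lt (by omega)] at e0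
  rw [h1, h1, ZMod.val_cast_of_lt (by omega), ZMod.val_cast_of_lt (by omega)] at e1
  exact Prod.ext e0 e1

/-- `3α_l/2 ≤ π`. [folklore] -/
theorem three_mul_boxAlpha_half_le (hl : 2 ≤ l) : 3 * (boxAlpha l / 2) ≤ π := by
  have h2 : (2 : ℝ) ≤ l := by exact_mod_cast hl
  have hD : (5 : ℝ) ≤ ((l : ℝ) - 1) * ((l : ℝ) + 3) := by nlinarith
  have hDpos : 0 < ((l : ℝ) - 1) * ((l : ℝ) + 3) := by linarith
  unfold boxAlpha
  rw [show 3 * (2 * π / (((l : ℝ) - 1) * ((l : ℝ) + 3)) / 2) = 3 * π / (((l : ℝ) - 1) * ((l : ℝ) + 3)) by ring,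
    div_le_iff₀ hDpos]
  nlinarith [Real.pi_pos]

/-- **THE SHARP FLOOR FOR THE BLOCK-INSERTION KERNEL** (`2 ≤ l`, `l + 1 ≤ L`, `β ≥ 0`,
`β cos(α_l/2) ≥ 1`, `λ ≥ 0`, any `η`; `θ = α_l/2 = π/N`, `N = (l+1)²−4 = (l−1)(l+3)`, `κ = β cos θ`):
`¼ e^{−β(L²−N)(1−cos(π/(L²−N−1)))} · e^{−(Nβ(1−cos θ) + β sin θ·η)} ·
 (1 − 2e^{−λη + Nλ²/(2κ)} − N·πe^{1/2}√κ·e^{−κ(1+cos 3θ)}) ≤ (μ_{β,L} ⊗ K_box){Q ≠ Q'}` — the VOLUME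
enters only through the first factor, which tends to `1`. [folklore] -/
theorem u1_boxInsertion_sharp_floor (hl : 2 ≤ l) (hlL : l + 1 ≤ L) {β lam η : ℝ} (hβ : 0 ≤ β)
    (hκ : 1 ≤ β * Real.cos (boxAlpha l / 2)) (hlam : 0 ≤ lam) :
    ENNReal.ofReal (4⁻¹ *
        Real.exp (-(β * (((L ^ 2 - ((l + 1) * (l + 1) - 4) : ℕ) : ℝ) *
          (1 - Real.cos (π / ((L ^ 2 - ((l + 1) * (l + 1) - 4) - 1 : ℕ) : ℝ)))))) *
        Real.exp (-((((l + 1) * (l + 1) - 4 : ℕ) : ℝ) * (β - β * Real.cos (boxAlpha l / 2)) +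
          β * Real.sin (boxAlpha l / 2) * η)) *
        (1 - 2 * Real.exp (-(lam * η) + (((l + 1) * (l + 1) - 4 : ℕ) : ℝ) *
              (lam ^ 2 / (2 * (β * Real.cos (boxAlpha l / 2))))) -
          (((l + 1) * (l + 1) - 4 : ℕ) : ℝ) * (π * Real.exp (1 / 2) * Real.sqrt (β * Real.cos (boxAlpha l / 2))) *
            Real.exp (-(β * Real.cos (boxAlpha l / 2) * (1 + Real.cos (3 * (boxAlpha l / 2))))))) ≤
      ((wilsonMeasure (d := 2) (L := L) u1Rep β) ⊗ₘ boxInsertionMH (L := L) β l)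
        {q | topCharge (0 : Site 2 L) 0 1 q.1 ≠ topCharge (0 : Site 2 L) 0 1 q.2} := by
  have hL : 2 ≤ L := by omega
  have hP : (boxSites l L).card + 3 ≤ L ^ 2 := by
    rw [card_boxSites hl hlL]
    have h4 : 4 ≤ (l + 1) * (l + 1) := by nlinarith
    have : (l + 1) * (l + 1) ≤ L ^ 2 := by nlinarith
    omega
  have hXP : ∀ x ∈ boxSites l L, plaquetteHolonomy (boxSpread l : GaugeConfig 2 L Circle) x 0 1 =
      Circle.exp (boxAlpha l / 2) * Circle.exp (boxAlpha l / 2) := by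
    intro x hx
    rw [plaquetteHolonomy_boxSpread hl hlL, boxF_of_inR (mem_boxSites.mp hx), ← Circle.exp_add]
    congr 1; ring
  have hXn : ∀ x ∉ boxSites l L, plaquetteHolonomy (boxSpread l : GaugeConfig 2 L Circle) x 0 1 = 1 := by
    intro x hx
    rw [plaquetteHolonomy_boxSpread hl hlL, boxF_of_not_inR (fun h => hx (mem_boxSites.mpr h)),
      Circle.exp_zero]
  have hQ : ∀ U : GaugeConfig 2 L Circle,
      (∀ x ∈ boxSites l L, 2 * (boxAlpha l / 2) - π < abelianFieldTensor U x 0 1 ∧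
        abelianFieldTensor U x 0 1 ≤ π - 2 * (boxAlpha l / 2)) →
      topCharge (0 : Site 2 L) 0 1 ((boxSpread l : GaugeConfig 2 L Circle) * U) ≠
        topCharge (0 : Site 2 L) 0 1 U := by
    intro U hU
    refine (bothChange_of_boxBranch hl hlL (U := U) fun x hxR => ?_).1
    have h := hU x (mem_boxSites.mpr hxR)
    rwa [show 2 * (boxAlpha l / 2) = boxAlpha l by ring] at h
  have h := u1_patchInsertion_sharp_floor hL (θ := boxAlpha l / 2) (η := η) hβ
    (by linarith [boxAlpha_pos hl]) (three_mul_boxAlpha_half_le hl) hκ hlam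
    (boxSpread l) (boxSpread l) (Or.inl rfl) (boxSites l L) hP hXP hXn hQ
  rw [card_boxSites hl hlL] at h
  exact h

/-- **The block floor in real numbers.** [folklore] -/
theorem u1_boxInsertion_sharp_floor_real (hl : 2 ≤ l) (hlL : l + 1 ≤ L) {β lam η : ℝ} (hβ : 0 ≤ β)
    (hκ : 1 ≤ β * Real.cos (boxAlpha l / 2)) (hlam : 0 ≤ lam) :
    4⁻¹ *
        Real.exp (-(β * (((L ^ 2 - ((l + 1) * (l + 1) - 4) : ℕ) : ℝ) *
          (1 - Real.cos (π / ((L ^ 2 - ((l + 1) * (l + 1) - 4) - 1 : ℕ) : ℝ)))))) *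
        Real.exp (-((((l + 1) * (l + 1) - 4 : ℕ) : ℝ) * (β - β * Real.cos (boxAlpha l / 2)) +
          β * Real.sin (boxAlpha l / 2) * η)) *
        (1 - 2 * Real.exp (-(lam * η) + (((l + 1) * (l + 1) - 4 : ℕ) : ℝ) *
              (lam ^ 2 / (2 * (β * Real.cos (boxAlpha l / 2))))) -
          (((l + 1) * (l + 1) - 4 : ℕ) : ℝ) * (π * Real.exp (1 / 2) * Real.sqrt (β * Real.cos (boxAlpha l / 2))) *
            Real.exp (-(β * Real.cos (boxAlpha l / 2) * (1 + Real.cos (3 * (boxAlpha l / 2)))))) ≤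
      ((wilsonMeasure (d := 2) (L := L) u1Rep β) ⊗ₘ boxInsertionMH (L := L) β l).real
        {q | topCharge (0 : Site 2 L) 0 1 q.1 ≠ topCharge (0 : Site 2 L) 0 1 q.2} := by
  haveI : IsProbabilityMeasure (wilsonMeasure (d := 2) (L := L) u1Rep β) :=
    isProbabilityMeasure_wilsonMeasure u1Rep continuous_u1Rep β
  rw [measureReal_def]
  exact (ENNReal.ofReal_le_iff_le_toReal (measure_ne_top _ _)).mp
    (u1_boxInsertion_sharp_floor hl hlL hβ hκ hlam)

end TwoDim

end Summit.Ventures.LatticeQCDFlow.Theory2.Lattice.Flux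

end
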